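import Summits.HodgeConjecture.CorCM.IrreducibleOddWeightsIsotypicComponents
import HarnessLib

/-!
# Isotypic cells, Frobenius I: THE HOM-SPACE `Hom_G(ℚ^{Y₀}, A)` OF A TRANSITIVE SLOT IS THE SPACE OF
# `Stab(x₀)`-INVARIANTS OF `A` — evaluation at `δ_{x₀}` is injective with image exactly `A^{H}`

COR-CM (cell `pub-hodgecm2`, binder seat `b16` gen 77, count-neutral claim FROBENIUS RECIPROCITY IN THE REFERENCE
CURRENCY — MULTIPLICITIES FROM FIXED POINTS, file R1 — abstract `G`-set level; theorems only, no definition, no named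
fact, no `sorry`).  NEW as stated, hence under `Summits/`.  HONEST FRAMING: finite-dimensional linear algebra
(Frobenius reciprocity `Hom_G(Ind_H^G 𝟙, A) ≅ A^H` for the permutation module of a transitive `G`-set, written in
the unbundled translate currency of the lane's isotypic files E1–E11 of gen 76); for `Y₀ = Hom(K, ℂ)` (one
`Aut(ℂ)`-orbit, `H = Aut(ℂ/x₀K)`) it is the first half of «the multiplicity of an irreducible constituent `A_c` of
`ℚ^{Hom(K,ℂ)}` is `dim A_c^{H}/δ_c`» (file R2); nothing about Hodge classes is asserted, `HC_CM` is neither used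
nor asserted.

SETTING.  `G` any group; `Y₀` a finite `G`-set (the slot) with a point `x₀`, TRANSITIVE in the form
`∀ x, ∃ g, g·x₀ = x`; `Y` a `G`-set (the ambient of the reference); `A ≤ ℚ^Y` a stable subspace.  Two parameter
subspaces, each carried with its characterising hypothesis (like the commutant `𝒟` of gen 72 C1):
* the HOM-SPACE `𝓗 ≤ Hom_ℚ(ℚ^{Y₀}, ℚ^Y)`: `L ∈ 𝓗 ⟺ L(ℚ^{Y₀}) ⊆ A` and `L(f∘(k•)) = (L f)∘(k•)` for all `k ∈ G`
  (`exists_homSpace` shows it is inhabited) — `𝓗 = Hom_G(ℚ^{Y₀}, A)`;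
* the FIXED SUBSPACE `F ≤ ℚ^Y` of the stabiliser `H = Stab(x₀)`: `f ∈ F ⟺ f∘(k•) = f` whenever `k·x₀ = x₀`
  (`exists_fixedSubmodule`) — so `A ⊓ F = A^H`.

* §1 `exists_homSpace`, `exists_fixedSubmodule`; closure of `𝓗` under the commutant on the left
  (`commutant_comp_mem_homSpace`) and production of commutant elements `L ∘ θ ∈ 𝒟` from equivariant
  `θ : ℚ^Y → ℚ^{Y₀}` (`comp_mem_commutant_of_mem_homSpace`); an `𝓗`-map KILLS every equivariant image of a stable
  irreducible `A′` that does not embed into `A` (`apply_eq_zero_of_mem_homSpace_of_not_embed`, Schur).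
* §2 FROBENIUS: `single_comp_smul` (`δ_{x₀}∘(k•) = δ_{k⁻¹x₀}`), `apply_single_smul_of_mem_homSpace`
  (`L(δ_{g x₀}) = L(δ_{x₀})∘(g⁻¹•)`), **`eq_zero_of_mem_homSpace_of_apply_single_eq_zero`** (evaluation at `δ_{x₀}`
  is INJECTIVE on `𝓗`), `apply_single_mem_inf_of_mem_homSpace` (`L(δ_{x₀}) ∈ A ⊓ F`),
  **`exists_mem_homSpace_apply_single_eq`** (every `v ∈ A ⊓ F` is `L(δ_{x₀})`: `L f = Σ_x f(x)·v∘(s(x)⁻¹•)` for a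
  section `s`, well defined on `F`), **`map_homSpace_applyₗ_single_eq`** (`ev_{x₀}(𝓗) = A ⊓ F`) and
  **`finrank_homSpace_eq`: `dim Hom_G(ℚ^{Y₀}, A) = dim A^{H}`**.
Sequel R2 `CorCM/IrreducibleOddWeightsIsotypicFrobeniusMultiplicity`: `dim Hom_G(ℚ^{Y₀}, A_c) = m_c·δ_c` through
the isotypic decomposition, whence `m_c·δ_c = dim A_c^H`.

## References

* [Serre1977] J.-P. Serre, *Linear Representations of Finite Groups*, GTM 42, §3.3 (induced representations,
  Lemma 1) and §7.2 Thm. 13 (Frobenius reciprocity).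
* [LangeRodriguez2022] H. Lange, R. E. Rodríguez, *Decomposition of Jacobians by Prym Varieties*, LNM 2310 (2022),
  §2.8, eq. (2.18) `⟨ρ_H, V⟩ = dim V^H` and Lemma 2.8.1 (rational isotypical decomposition of `ρ_H = Ind_H^G 𝟙`:
  multiplicity of `W_j` is `dim(V_j^H)/s_j`).
* [CurtisReiner1962] C. W. Curtis, I. Reiner, *Representation Theory of Finite Groups and Associative Algebras*,
  §27 (27.3) (Schur).
-/

set_option autoImplicit false

noncomputable section

open scoped BigOperators

universe v v' v'' w

namespace Summit.HodgeConjecture.CorCM.IrrOdd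

variable {G : Type w} [Group G] {Y₀ : Type v} [MulAction G Y₀] {Y : Type v'} [MulAction G Y]

/-! ### §1 The Hom-space `Hom_G(ℚ^{Y₀}, A)` and the fixed subspace of the stabiliser -/

section HomSpace

omit [Group G] [MulAction G Y₀] [MulAction G Y] in
/-- **THE HOM-SPACE EXISTS**: the linear maps `L : ℚ^{Y₀} → ℚ^Y` with values in `A` commuting with the translates
form a subspace `𝓗 = Hom_G(ℚ^{Y₀}, A)` of `Hom_ℚ(ℚ^{Y₀}, ℚ^Y)` — the shape in which every later statement takes it
as a parameter. [cite: Serre1977, §3.3 Lemma 1] -/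
theorem exists_homSpace [SMul G Y₀] [SMul G Y] (A : Submodule ℚ (Y → ℚ)) :
    ∃ 𝓗 : Submodule ℚ ((Y₀ → ℚ) →ₗ[ℚ] (Y → ℚ)), ∀ L : (Y₀ → ℚ) →ₗ[ℚ] (Y → ℚ),
      L ∈ 𝓗 ↔ (∀ f, L f ∈ A) ∧ ∀ (k : G) (f : Y₀ → ℚ), L (fun x => f (k • x)) = fun y => L f (k • y) := by
  refine ⟨{ carrier := {L | (∀ f, L f ∈ A) ∧
              ∀ (k : G) (f : Y₀ → ℚ), L (fun x => f (k • x)) = fun y => L f (k • y)}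
            add_mem' := ?_
            zero_mem' := ?_
            smul_mem' := ?_ }, fun L => Iff.rfl⟩
  · intro L L' hL hL'
    refine ⟨fun f => by rw [LinearMap.add_apply]; exact A.add_mem (hL.1 f) (hL'.1 f), fun k f => ?_⟩
    funext y
    simp only [LinearMap.add_apply, Pi.add_apply, hL.2 k f, hL'.2 k f]
  · refine ⟨fun f => by rw [LinearMap.zero_apply]; exact A.zero_mem, fun k f => ?_⟩
    funext y
    simp only [LinearMap.zero_apply, Pi.zero_apply]
  · intro t L hL
    refine ⟨fun f => by rw [LinearMap.smul_apply]; exact A.smul_mem t (hL.1 f), fun k f => ?_⟩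
    funext y
    simp only [LinearMap.smul_apply, Pi.smul_apply, hL.2 k f]

omit [Group G] [MulAction G Y₀] [MulAction G Y] in
/-- **THE FIXED SUBSPACE OF THE STABILISER EXISTS**: the `f : Y → ℚ` with `f∘(k•) = f` for every `k` fixing `x₀`
form a subspace `F` of `ℚ^Y` (`A ⊓ F = A^{Stab(x₀)}`). [cite: Serre1977, §7.2 Thm. 13] -/
theorem exists_fixedSubmodule [SMul G Y₀] [SMul G Y] (x₀ : Y₀) :
    ∃ F : Submodule ℚ (Y → ℚ), ∀ f : Y → ℚ,
      f ∈ F ↔ ∀ k : G, k • x₀ = x₀ → (fun y => f (k • y)) = f := by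
  refine ⟨{ carrier := {f | ∀ k : G, k • x₀ = x₀ → (fun y => f (k • y)) = f}
            add_mem' := ?_
            zero_mem' := ?_
            smul_mem' := ?_ }, fun f => Iff.rfl⟩
  · intro f g hf hg k hk
    funext y
    have h1 := congrFun (hf k hk) y
    have h2 := congrFun (hg k hk) y
    simp only [Pi.add_apply] at h1 h2 ⊢
    rw [h1, h2]
  · intro k _
    funext y
    simp only [Pi.zero_apply]
  · intro t f hf k hk
    funext y
    have h1 := congrFun (hf k hk) y
    simp only [Pi.smul_apply] at h1 ⊢
    rw [h1]

variable {A : Submodule ℚ (Y → ℚ)} {𝓗 : Submodule ℚ ((Y₀ → ℚ) →ₗ[ℚ] (Y → ℚ))}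

omit [Group G] [MulAction G Y₀] [MulAction G Y] in
/-- **THE COMMUTANT ACTS ON THE HOM-SPACE**: `d ∘ L ∈ 𝓗` for `d ∈ 𝒟` (the commutant of `A`, translate form) and
`L ∈ 𝓗`. [cite: CurtisReiner1962, §27 (27.3)] -/
theorem commutant_comp_mem_homSpace [SMul G Y₀] [SMul G Y]
    (h𝓗 : ∀ L : (Y₀ → ℚ) →ₗ[ℚ] (Y → ℚ), L ∈ 𝓗 ↔ (∀ f, L f ∈ A) ∧
      ∀ (k : G) (f : Y₀ → ℚ), L (fun x => f (k • x)) = fun y => L f (k • y))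
    {𝒟 : Submodule ℚ ((Y → ℚ) →ₗ[ℚ] (Y → ℚ))}
    (h𝒟 : ∀ L : (Y → ℚ) →ₗ[ℚ] (Y → ℚ), L ∈ 𝒟 ↔ (∀ a ∈ A, L a ∈ A) ∧
      ∀ (k : G) (a : Y → ℚ), a ∈ A → L (fun y => a (k • y)) = fun y => L a (k • y))
    {d : (Y → ℚ) →ₗ[ℚ] (Y → ℚ)} (hd : d ∈ 𝒟) {L : (Y₀ → ℚ) →ₗ[ℚ] (Y → ℚ)} (hL : L ∈ 𝓗) :
    d ∘ₗ L ∈ 𝓗 := by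
  obtain ⟨hLA, hLeq⟩ := (h𝓗 L).1 hL
  obtain ⟨hdA, hdeq⟩ := (h𝒟 d).1 hd
  refine (h𝓗 _).2 ⟨fun f => hdA _ (hLA f), fun k f => ?_⟩
  rw [LinearMap.comp_apply, LinearMap.comp_apply, hLeq k f, hdeq k _ (hLA f)]

omit [Group G] [MulAction G Y₀] [MulAction G Y] in
/-- **PRECOMPOSITION WITH AN EQUIVARIANT MAP GIVES A COMMUTANT ELEMENT**: for `L ∈ 𝓗` and `θ : ℚ^Y → ℚ^{Y₀}`
equivariant on `A`, `L ∘ θ ∈ 𝒟` (it maps `A` — indeed everything — into `A` and commutes with the translates on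
`A`). [cite: CurtisReiner1962, §27 (27.3)] -/
theorem comp_mem_commutant_of_mem_homSpace [SMul G Y₀] [SMul G Y]
    (h𝓗 : ∀ L : (Y₀ → ℚ) →ₗ[ℚ] (Y → ℚ), L ∈ 𝓗 ↔ (∀ f, L f ∈ A) ∧
      ∀ (k : G) (f : Y₀ → ℚ), L (fun x => f (k • x)) = fun y => L f (k • y))
    {𝒟 : Submodule ℚ ((Y → ℚ) →ₗ[ℚ] (Y → ℚ))}
    (h𝒟 : ∀ L : (Y → ℚ) →ₗ[ℚ] (Y → ℚ), L ∈ 𝒟 ↔ (∀ a ∈ A, L a ∈ A) ∧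
      ∀ (k : G) (a : Y → ℚ), a ∈ A → L (fun y => a (k • y)) = fun y => L a (k • y))
    {L : (Y₀ → ℚ) →ₗ[ℚ] (Y → ℚ)} (hL : L ∈ 𝓗) (θ : (Y → ℚ) →ₗ[ℚ] (Y₀ → ℚ))
    (hθeq : ∀ (k : G) (a : Y → ℚ), a ∈ A → θ (fun y => a (k • y)) = fun x => θ a (k • x)) :
    L ∘ₗ θ ∈ 𝒟 := by
  obtain ⟨hLA, hLeq⟩ := (h𝓗 L).1 hL
  refine (h𝒟 _).2 ⟨fun a _ => hLA _, fun k a ha => ?_⟩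
  rw [LinearMap.comp_apply, LinearMap.comp_apply, hθeq k a ha, hLeq k]

/-- **AN `𝓗`-MAP KILLS EVERY EQUIVARIANT IMAGE OF A STABLE IRREDUCIBLE `A′` THAT DOES NOT EMBED INTO `A`**: if
`θ : ℚ^{Y′} → ℚ^{Y₀}` is equivariant on the stable irreducible `A′ ≤ ℚ^{Y′}` and no linear `ℚ^{Y′} → ℚ^Y` maps `A′`
into `A` injectively and equivariantly, then `L(θ a) = 0` for all `a ∈ A′` and `L ∈ 𝓗` (`L ∘ θ` is equivariant on
`A′` with values in `A`, hence zero or injective on `A′` by Schur). [cite: Serre1977, §2.2]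
[cite: CurtisReiner1962, §27 (27.3)] -/
theorem apply_eq_zero_of_mem_homSpace_of_not_embed
    (h𝓗 : ∀ L : (Y₀ → ℚ) →ₗ[ℚ] (Y → ℚ), L ∈ 𝓗 ↔ (∀ f, L f ∈ A) ∧
      ∀ (k : G) (f : Y₀ → ℚ), L (fun x => f (k • x)) = fun y => L f (k • y))
    {L : (Y₀ → ℚ) →ₗ[ℚ] (Y → ℚ)} (hL : L ∈ 𝓗)
    {Y' : Type v''} [MulAction G Y'] {A' : Submodule ℚ (Y' → ℚ)}
    (hA'st : ∀ (k : G) (a : Y' → ℚ), a ∈ A' → (fun y => a (k • y)) ∈ A')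
    (hA'irr : ∀ W : Submodule ℚ (Y' → ℚ), W ≤ A' → W ≠ ⊥ →
      (∀ (k : G) (f : Y' → ℚ), f ∈ W → (fun y => f (k • y)) ∈ W) → W = A')
    (θ : (Y' → ℚ) →ₗ[ℚ] (Y₀ → ℚ))
    (hθeq : ∀ (k : G) (a : Y' → ℚ), a ∈ A' → θ (fun y => a (k • y)) = fun x => θ a (k • x))
    (hsep : ∀ L' : (Y' → ℚ) →ₗ[ℚ] (Y → ℚ), (∀ a ∈ A', L' a ∈ A) → (∀ a ∈ A', L' a = 0 → a = 0) →
      (∀ (k : G) (a : Y' → ℚ), a ∈ A' → L' (fun y => a (k • y)) = fun y => L' a (k • y)) → False) :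
    ∀ a ∈ A', L (θ a) = 0 := by
  obtain ⟨hLA, hLeq⟩ := (h𝓗 L).1 hL
  have heq : ∀ (k : G) (a : Y' → ℚ), a ∈ A' →
      (L ∘ₗ θ) (fun y => a (k • y)) = fun y => (L ∘ₗ θ) a (k • y) := fun k a ha => by
    rw [LinearMap.comp_apply, LinearMap.comp_apply, hθeq k a ha, hLeq k]
  intro a₁ ha₁
  by_contra hne
  refine hsep (L ∘ₗ θ) (fun a _ => hLA _) ?_ heq
  refine injOn_of_irreducible_of_map_ne_bot (L ∘ₗ θ) (fun k : G => LinearMap.funLeft ℚ ℚ fun y : Y => k • y)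
    hA'st hA'irr (fun k a ha => heq k a ha) fun hbot => hne ?_
  have hmem : (L ∘ₗ θ) a₁ ∈ A'.map (L ∘ₗ θ) := Submodule.mem_map_of_mem ha₁
  rw [hbot, Submodule.mem_bot] at hmem
  exact hmem

end HomSpace

/-! ### §2 Frobenius reciprocity: evaluation at `δ_{x₀}` identifies `Hom_G(ℚ^{Y₀}, A)` with `A^{Stab(x₀)}` -/

section Frobenius

variable {A : Submodule ℚ (Y → ℚ)} {𝓗 : Submodule ℚ ((Y₀ → ℚ) →ₗ[ℚ] (Y → ℚ))} {F : Submodule ℚ (Y → ℚ)}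

omit [MulAction G Y] in
/-- `δ_{x₀}∘(k•) = δ_{k⁻¹ x₀}` in `ℚ^{Y₀}`. [cite: Serre1977, §3.3] -/
theorem single_comp_smul [DecidableEq Y₀] (x₀ : Y₀) (k : G) :
    (fun x => (Pi.single x₀ (1 : ℚ) : Y₀ → ℚ) (k • x)) = Pi.single (k⁻¹ • x₀) (1 : ℚ) := by
  funext x
  by_cases hx : x = k⁻¹ • x₀
  · subst hx
    rw [smul_inv_smul, Pi.single_eq_same, Pi.single_eq_same]
  · have hx' : k • x ≠ x₀ := fun h => hx (by rw [← h, inv_smul_smul])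
    rw [Pi.single_eq_of_ne hx', Pi.single_eq_of_ne hx]

/-- **`L(δ_{g x₀}) = L(δ_{x₀})∘(g⁻¹•)`** for `L ∈ 𝓗`. [cite: Serre1977, §3.3 Lemma 1] -/
theorem apply_single_smul_of_mem_homSpace [DecidableEq Y₀]
    (h𝓗 : ∀ L : (Y₀ → ℚ) →ₗ[ℚ] (Y → ℚ), L ∈ 𝓗 ↔ (∀ f, L f ∈ A) ∧
      ∀ (k : G) (f : Y₀ → ℚ), L (fun x => f (k • x)) = fun y => L f (k • y))
    {L : (Y₀ → ℚ) →ₗ[ℚ] (Y → ℚ)} (hL : L ∈ 𝓗) (x₀ : Y₀) (g : G) :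
    L (Pi.single (g • x₀) (1 : ℚ)) = fun y => L (Pi.single x₀ (1 : ℚ)) (g⁻¹ • y) := by
  have h := ((h𝓗 L).1 hL).2 g⁻¹ (Pi.single x₀ (1 : ℚ))
  rw [single_comp_smul, inv_inv] at h
  exact h

/-- **EVALUATION AT `δ_{x₀}` IS INJECTIVE ON `Hom_G(ℚ^{Y₀}, A)` FOR A TRANSITIVE SLOT**: `L(δ_{x₀}) = 0` forces
`L(δ_x) = 0` for every `x = g·x₀`, and the `δ_x` span `ℚ^{Y₀}`. [cite: Serre1977, §3.3 Lemma 1]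
[cite: LangeRodriguez2022, §2.8 eq. (2.18)] -/
theorem eq_zero_of_mem_homSpace_of_apply_single_eq_zero [Finite Y₀] [DecidableEq Y₀]
    (h𝓗 : ∀ L : (Y₀ → ℚ) →ₗ[ℚ] (Y → ℚ), L ∈ 𝓗 ↔ (∀ f, L f ∈ A) ∧
      ∀ (k : G) (f : Y₀ → ℚ), L (fun x => f (k • x)) = fun y => L f (k • y))
    {x₀ : Y₀} (htr : ∀ x : Y₀, ∃ g : G, g • x₀ = x)
    {L : (Y₀ → ℚ) →ₗ[ℚ] (Y → ℚ)} (hL : L ∈ 𝓗) (h0 : L (Pi.single x₀ (1 : ℚ)) = 0) : L = 0 := by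
  refine (Pi.basisFun ℚ Y₀).ext fun x => ?_
  obtain ⟨g, hg⟩ := htr x
  rw [Pi.basisFun_apply, LinearMap.zero_apply, ← hg, apply_single_smul_of_mem_homSpace h𝓗 hL x₀ g, h0]
  rfl

/-- **`L(δ_{x₀})` IS A `Stab(x₀)`-INVARIANT OF `A`** for `L ∈ 𝓗`: `L(δ_{x₀}) ∈ A ⊓ F`.
[cite: Serre1977, §7.2 Thm. 13] [cite: LangeRodriguez2022, §2.8 eq. (2.18)] -/
theorem apply_single_mem_inf_of_mem_homSpace [DecidableEq Y₀]
    (h𝓗 : ∀ L : (Y₀ → ℚ) →ₗ[ℚ] (Y → ℚ), L ∈ 𝓗 ↔ (∀ f, L f ∈ A) ∧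
      ∀ (k : G) (f : Y₀ → ℚ), L (fun x => f (k • x)) = fun y => L f (k • y))
    {x₀ : Y₀} (hF : ∀ f : Y → ℚ, f ∈ F ↔ ∀ k : G, k • x₀ = x₀ → (fun y => f (k • y)) = f)
    {L : (Y₀ → ℚ) →ₗ[ℚ] (Y → ℚ)} (hL : L ∈ 𝓗) : L (Pi.single x₀ (1 : ℚ)) ∈ A ⊓ F := by
  obtain ⟨hLA, hLeq⟩ := (h𝓗 L).1 hL
  refine Submodule.mem_inf.2 ⟨hLA _, (hF _).2 fun k hk => ?_⟩
  have h := hLeq k (Pi.single x₀ (1 : ℚ))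
  have hk' : k⁻¹ • x₀ = x₀ := by rw [inv_smul_eq_iff, hk]
  rw [single_comp_smul, hk'] at h
  exact h.symm

/-- **EVERY `Stab(x₀)`-INVARIANT `v ∈ A` IS `L(δ_{x₀})` FOR SOME `L ∈ Hom_G(ℚ^{Y₀}, A)`** (transitive slot,
`A` stable): with a section `s` of the orbit map (`s(x)·x₀ = x`) put `L f = Σ_x f(x)·v∘(s(x)⁻¹•)` — equivariant
because `s(x)⁻¹ k s(k⁻¹x)` fixes `x₀` and `v` is invariant, and `L(δ_{x₀}) = v∘(s(x₀)⁻¹•) = v`.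
[cite: Serre1977, §3.3 Lemma 1 and §7.2 Thm. 13] [cite: LangeRodriguez2022, §2.8 eq. (2.18)] -/
theorem exists_mem_homSpace_apply_single_eq [Fintype Y₀] [DecidableEq Y₀]
    (h𝓗 : ∀ L : (Y₀ → ℚ) →ₗ[ℚ] (Y → ℚ), L ∈ 𝓗 ↔ (∀ f, L f ∈ A) ∧
      ∀ (k : G) (f : Y₀ → ℚ), L (fun x => f (k • x)) = fun y => L f (k • y))
    (hAst : ∀ (k : G) (a : Y → ℚ), a ∈ A → (fun y => a (k • y)) ∈ A)
    {x₀ : Y₀} (htr : ∀ x : Y₀, ∃ g : G, g • x₀ = x)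
    {v : Y → ℚ} (hvA : v ∈ A) (hvF : ∀ k : G, k • x₀ = x₀ → (fun y => v (k • y)) = v) :
    ∃ L ∈ 𝓗, L (Pi.single x₀ (1 : ℚ)) = v := by
  choose s hs using htr
  let L : (Y₀ → ℚ) →ₗ[ℚ] (Y → ℚ) :=
    ∑ x, (LinearMap.proj x : (Y₀ → ℚ) →ₗ[ℚ] ℚ).smulRight (fun y => v ((s x)⁻¹ • y))
  have hLapply : ∀ f : Y₀ → ℚ, L f = ∑ x, f x • (fun y => v ((s x)⁻¹ • y)) := fun f => by
    simp only [L, LinearMap.sum_apply, LinearMap.smulRight_apply, LinearMap.proj_apply]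
  refine ⟨L, (h𝓗 L).2 ⟨fun f => ?_, fun k f => ?_⟩, ?_⟩
  · rw [hLapply]
    exact Submodule.sum_mem _ fun x _ => Submodule.smul_mem _ _ (hAst (s x)⁻¹ v hvA)
  · rw [hLapply, hLapply]
    funext y
    rw [Finset.sum_apply, Finset.sum_apply]
    simp only [Pi.smul_apply, smul_eq_mul]
    rw [Fintype.sum_equiv (MulAction.toPerm k) (fun x => f (k • x) * v ((s x)⁻¹ • y))
      (fun x => f x * v ((s (k⁻¹ • x))⁻¹ • y))
      (fun x => by simp only [MulAction.toPerm_apply, inv_smul_smul])]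
    refine Finset.sum_congr rfl fun x _ => ?_
    -- `h = s(x)⁻¹ k s(k⁻¹x)` fixes `x₀`
    have hmem : ((s x)⁻¹ * k * s (k⁻¹ • x)) • x₀ = x₀ := by
      rw [mul_smul, mul_smul, hs (k⁻¹ • x), smul_inv_smul, inv_smul_eq_iff, hs x]
    have hfix := congrFun (hvF _ hmem) ((s (k⁻¹ • x))⁻¹ • y)
    rw [← hfix, smul_smul, mul_inv_cancel_right, mul_smul]
  · rw [hLapply, Finset.sum_eq_single x₀ (fun x _ hx => by rw [Pi.single_eq_of_ne hx, zero_smul])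
      (fun h => absurd (Finset.mem_univ x₀) h), Pi.single_eq_same, one_smul]
    have hmem : (s x₀)⁻¹ • x₀ = x₀ := by rw [inv_smul_eq_iff, hs]
    exact hvF _ hmem

/-- **FROBENIUS RECIPROCITY, IMAGE FORM: `ev_{x₀}(Hom_G(ℚ^{Y₀}, A)) = A ⊓ F = A^{Stab(x₀)}`** for a transitive slot
`Y₀ ∋ x₀` and a stable `A`. [cite: Serre1977, §7.2 Thm. 13] [cite: LangeRodriguez2022, §2.8 eq. (2.18)] -/
theorem map_homSpace_applyₗ_single_eq [Fintype Y₀] [DecidableEq Y₀]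
    (h𝓗 : ∀ L : (Y₀ → ℚ) →ₗ[ℚ] (Y → ℚ), L ∈ 𝓗 ↔ (∀ f, L f ∈ A) ∧
      ∀ (k : G) (f : Y₀ → ℚ), L (fun x => f (k • x)) = fun y => L f (k • y))
    {x₀ : Y₀} (hF : ∀ f : Y → ℚ, f ∈ F ↔ ∀ k : G, k • x₀ = x₀ → (fun y => f (k • y)) = f)
    (hAst : ∀ (k : G) (a : Y → ℚ), a ∈ A → (fun y => a (k • y)) ∈ A)
    (htr : ∀ x : Y₀, ∃ g : G, g • x₀ = x) :
    𝓗.map (LinearMap.applyₗ (Pi.single x₀ (1 : ℚ))) = A ⊓ F := by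
  refine le_antisymm ?_ fun v hv => ?_
  · rintro _ ⟨L, hL, rfl⟩
    rw [LinearMap.applyₗ_apply_apply]
    exact apply_single_mem_inf_of_mem_homSpace h𝓗 hF hL
  · obtain ⟨hvA, hvF⟩ := Submodule.mem_inf.1 hv
    obtain ⟨L, hL, hLv⟩ := exists_mem_homSpace_apply_single_eq h𝓗 hAst htr hvA ((hF v).1 hvF)
    exact ⟨L, hL, by rw [LinearMap.applyₗ_apply_apply, hLv]⟩

omit [Group G] [MulAction G Y₀] [MulAction G Y] in
/-- A linear map injective on a subspace `N` preserves its dimension: `dim θ(N) = dim N` (any modules).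
[folklore] -/
theorem finrank_map_eq_finrank_of_injOn {M : Type v} {M' : Type v'} [AddCommGroup M] [Module ℚ M]
    [AddCommGroup M'] [Module ℚ M'] (θ : M →ₗ[ℚ] M') (N : Submodule ℚ M)
    (hinj : ∀ n ∈ N, θ n = 0 → n = 0) : Module.finrank ℚ (N.map θ) = Module.finrank ℚ N := by
  have hi : Function.Injective (θ ∘ₗ N.subtype) := by
    intro x y hxy
    apply Subtype.ext
    have h0 : θ ((x : M) - y) = 0 := by
      rw [map_sub, sub_eq_zero]
      exact hxy
    exact sub_eq_zero.1 (hinj _ (N.sub_mem x.2 y.2) h0)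
  have h := LinearMap.finrank_range_of_inj hi
  rwa [LinearMap.range_comp, Submodule.range_subtype] at h

/-- **FROBENIUS RECIPROCITY: `dim Hom_G(ℚ^{Y₀}, A) = dim A^{Stab(x₀)}`** (`= dim(A ⊓ F)`) for a transitive slot
`Y₀ ∋ x₀` and a stable `A ≤ ℚ^Y` — evaluation at `δ_{x₀}` is injective on `𝓗` with image `A ⊓ F`.
[cite: Serre1977, §7.2 Thm. 13] [cite: LangeRodriguez2022, §2.8 eq. (2.18) and Lemma 2.8.1] -/
theorem finrank_homSpace_eq [Fintype Y₀]
    (h𝓗 : ∀ L : (Y₀ → ℚ) →ₗ[ℚ] (Y → ℚ), L ∈ 𝓗 ↔ (∀ f, L f ∈ A) ∧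
      ∀ (k : G) (f : Y₀ → ℚ), L (fun x => f (k • x)) = fun y => L f (k • y))
    {x₀ : Y₀} (hF : ∀ f : Y → ℚ, f ∈ F ↔ ∀ k : G, k • x₀ = x₀ → (fun y => f (k • y)) = f)
    (hAst : ∀ (k : G) (a : Y → ℚ), a ∈ A → (fun y => a (k • y)) ∈ A)
    (htr : ∀ x : Y₀, ∃ g : G, g • x₀ = x) :
    Module.finrank ℚ 𝓗 = Module.finrank ℚ ↥(A ⊓ F) := by
  classical
  rw [← map_homSpace_applyₗ_single_eq h𝓗 hF hAst htr]
  exact (finrank_map_eq_finrank_of_injOn _ 𝓗 fun L hL h0 =>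
    eq_zero_of_mem_homSpace_of_apply_single_eq_zero h𝓗 htr hL
      (by rwa [LinearMap.applyₗ_apply_apply] at h0)).symm

end Frobenius

end Summit.HodgeConjecture.CorCM.IrrOdd

end
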